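import Summits.AtomisticToContinuum.Crystallization.Theorems.ChargedEnergyGap.Negative.Periodisation

/-!
# `ChargedEnergyGap` (stmt-AtomisticToContinuum-14231), negative side V: the periodic form of the pricing implies the crux

`PeriodicPricing η κ → NoBoundary η κ`: far periodisation with period `8D + 8`, charge of motif points
read in the infinite point set equals charge in `y`.  All `[folklore]`.
-/

noncomputable section

namespace Summit.AtomisticToContinuum.Crystallization.Theorems.ChargedEnergyGapNegative

open Literature.MathematicalPhysics.StatisticalMechanics
open Literature.Geometry.DiscreteGeometry
open Summit.AtomisticToContinuum.Crystallization.Theses.PricedLinkCensus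
open scoped BigOperators

/-! ## §8. The periodic form of the pricing implies the crux

`PeriodicPricing η κ`: for EVERY periodic configuration `Q`, `κ·#(charged motif sites, charge read
in the infinite point set Q.points) ≤ #motif · (e(Q) − e*)`.  This implies `NoBoundary η κ`
(hence, at `η = 1/100` with `κ > 0`, the crux): periodise `y` with the LARGE period
`L(y) = 8D + 8`; the bond graph of the periodic point set restricted to the motif is the bond
graph of `y` (images are farther than twice any nearest-neighbour distance), so the charged motif
sites are exactly the charged sites of `y`, while `e(Q) ≤ E(y)/N`.  No `BddBelow` is needed in
this direction.  (The converse, crux ⇒ periodic form, needs block trial states — item 11865-type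
content — and is not attempted here.) -/

section PeriodicForm

variable {N : ℕ}

/-- Number of charged motif sites of a periodic configuration, charge being read in the infinite
point set `Q.points` (index type `Q.points`, configuration `Subtype.val`). [folklore] -/
def motifCharged (η : ℝ) (Q : PeriodicConfiguration 3) : ℕ :=
  Nat.card {x : Q.motif //
    ¬ IsChargeFree η (Subtype.val : Q.points → E3) ⟨x.1, Q.mem_points_of_mem_motif x.2⟩}

/-- **Periodic pricing**: every periodic configuration pays `κ` per charged motif site above `e*`. [folklore] -/
def PeriodicPricing (η κ : ℝ) : Prop :=
  ∀ Q : PeriodicConfiguration 3,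
    κ * (motifCharged η Q : ℝ) ≤ (Q.motif.card : ℝ) * (Q.energyPerParticle lennardJones - eStar)

/-- The large period `L(y) = 8D + 8` as a unit. [folklore] -/
def spacingUnit (y : Fin N → E3) : ℝˣ :=
  Units.mk0 (spacing y) (by have := one_le_spacing_sub y; linarith [Dsum_nonneg y])

/-- Its value. [folklore] -/
@[simp] theorem val_spacingUnit (y : Fin N → E3) : (spacingUnit y : ℝ) = spacing y := rfl

/-- `2D + 2 ≤ 8D + 8`. [folklore] -/
theorem period_le_spacing (y : Fin N → E3) : period y ≤ (spacingUnit y : ℝ) := by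
  rw [val_spacingUnit]; unfold period spacing; linarith [Dsum_nonneg y]

/-- The far periodisation `y + (8D+8)ℤ³`. [folklore] -/
def periodiseFar (y : Fin N → E3) (hN : 0 < N) : PeriodicConfiguration 3 :=
  periodise y (spacingUnit y) (period_le_spacing y) hN

/-- The motif of the far periodisation is `{yᵢ}`. [folklore] -/
theorem motif_periodiseFar (y : Fin N → E3) (hN : 0 < N) :
    (periodiseFar y hN).motif = Finset.univ.image y := rfl

/-- The motif points of the far periodisation, as points of it. [folklore] -/
def toPoint (y : Fin N → E3) (hN : 0 < N) (i : Fin N) : (periodiseFar y hN).points :=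
  ⟨y i, (periodiseFar y hN).mem_points_of_mem_motif (by
    rw [motif_periodiseFar]; exact Finset.mem_image_of_mem y (Finset.mem_univ i))⟩

/-- Its value. [folklore] -/
@[simp] theorem val_toPoint (y : Fin N → E3) (hN : 0 < N) (i : Fin N) :
    ((toPoint y hN i : (periodiseFar y hN).points) : E3) = y i := rfl

/-- `toPoint` is injective for injective `y`. [folklore] -/
theorem toPoint_injective {y : Fin N → E3} (hy : Function.Injective y) (hN : 0 < N) :
    Function.Injective (toPoint y hN) := fun _ _ h => hy (congrArg Subtype.val h)

/-- Dichotomy for points of the far periodisation: a motif point `yⱼ`, or far from every `yᵢ`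
(distance `≥ 6D + 8`). [folklore] -/
theorem eq_toPoint_or_far {y : Fin N → E3} (hN : 0 < N) (p : (periodiseFar y hN).points) :
    (∃ j, p = toPoint y hN j) ∨ ∀ i, 6 * Dsum y + 8 ≤ dist (y i) p := by
  by_cases h : ∃ j, (p : E3) = y j
  · obtain ⟨j, hj⟩ := h
    exact Or.inl ⟨j, Subtype.ext hj⟩
  · push Not at h
    refine Or.inr fun i => ?_
    have := sub_le_dist_of_mem_points y (spacingUnit y) (period_le_spacing y) hN i p.2 h
    rw [val_spacingUnit] at this
    unfold spacing at this
    linarith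

/-- Nearest-neighbour distances of motif points, read in the periodic point set, are those of
`y` (`y` injective, `N ≥ 2`). [folklore] -/
theorem nearestDist_toPoint {y : Fin N → E3} (hy : Function.Injective y) (hN : 0 < N)
    {i : Fin N} (hi : ∃ j, j ≠ i) :
    nearestDist (Subtype.val : (periodiseFar y hN).points → E3) (toPoint y hN i) =
      nearestDist y i := by
  obtain ⟨j₀, hj₀, hnn⟩ := exists_nearestDist_eq_dist y hi
  have hne0 : toPoint y hN j₀ ≠ toPoint y hN i := fun h => hj₀ (toPoint_injective hy hN h)
  apply le_antisymm
  · calc nearestDist (Subtype.val : (periodiseFar y hN).points → E3) (toPoint y hN i)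
        ≤ dist ((toPoint y hN i : (periodiseFar y hN).points) : E3) (toPoint y hN j₀) :=
          nearestDist_le_dist _ hne0
      _ = nearestDist y i := by simp [hnn]
  · refine le_nearestDist ⟨toPoint y hN j₀, hne0⟩ fun q hq => ?_
    rcases eq_toPoint_or_far hN q with ⟨j, rfl⟩ | hfar
    · have hji : j ≠ i := fun h => hq (by rw [h])
      simpa using nearestDist_le_dist y hji
    · calc nearestDist y i ≤ 2 * Dsum y := nearestDist_le_two_Dsum y hj₀
        _ ≤ 6 * Dsum y + 8 := by linarith [Dsum_nonneg y]
        _ ≤ dist (y i) q := hfar i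

/-- Bonds at motif points of the far periodisation are exactly the bonds of `y` (`η ≤ 1`). [folklore] -/
theorem adj_toPoint_iff {y : Fin N → E3} (hy : Function.Injective y) (hN : 0 < N) {η : ℝ}
    (hη1 : η ≤ 1) (hN2 : ∀ i : Fin N, ∃ j, j ≠ i) (i : Fin N) (q : (periodiseFar y hN).points) :
    (bondGraph η (Subtype.val : (periodiseFar y hN).points → E3)).Adj (toPoint y hN i) q ↔
      ∃ j, q = toPoint y hN j ∧ (bondGraph η y).Adj i j := by
  constructor
  · intro h
    obtain ⟨hne, hle⟩ := bondGraph_adj.1 h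
    rw [nearestDist_toPoint hy hN (hN2 i)] at hle
    rcases eq_toPoint_or_far hN q with ⟨j, rfl⟩ | hfar
    · refine ⟨j, rfl, bondGraph_adj.2 ⟨fun h' => hne (by rw [h']), ?_⟩⟩
      rw [nearestDist_toPoint hy hN (hN2 j)] at hle
      simpa using hle
    · exfalso
      obtain ⟨j₀, hj₀⟩ := hN2 i
      have hnn : nearestDist y i ≤ 2 * Dsum y := nearestDist_le_two_Dsum y hj₀
      have hmin : min (nearestDist y i)
          (nearestDist (Subtype.val : (periodiseFar y hN).points → E3) q) ≤ 2 * Dsum y :=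
        (min_le_left _ _).trans hnn
      have h1 : (1 + η) * min (nearestDist y i)
          (nearestDist (Subtype.val : (periodiseFar y hN).points → E3) q) ≤ 2 * (2 * Dsum y) :=
        mul_le_mul (by linarith) hmin (le_min (nearestDist_nonneg _ _) (nearestDist_nonneg _ _))
          (by norm_num)
      have h2 := hfar i
      simp only [val_toPoint] at hle
      linarith [Dsum_nonneg y]
  · rintro ⟨j, rfl, hadj⟩
    obtain ⟨hne, hle⟩ := bondGraph_adj.1 hadj
    refine bondGraph_adj.2 ⟨fun h => hne (toPoint_injective hy hN h), ?_⟩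
    rw [nearestDist_toPoint hy hN (hN2 i), nearestDist_toPoint hy hN (hN2 j)]
    simpa using hle

/-- Neighbour sets of motif points are the images of the neighbour sets of `y`. [folklore] -/
theorem neighborSet_toPoint {y : Fin N → E3} (hy : Function.Injective y) (hN : 0 < N) {η : ℝ}
    (hη1 : η ≤ 1) (hN2 : ∀ i : Fin N, ∃ j, j ≠ i) (i : Fin N) :
    (bondGraph η (Subtype.val : (periodiseFar y hN).points → E3)).neighborSet (toPoint y hN i) =
      toPoint y hN '' (bondGraph η y).neighborSet i := by
  ext q
  rw [SimpleGraph.mem_neighborSet, adj_toPoint_iff hy hN hη1 hN2, Set.mem_image]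
  constructor
  · rintro ⟨j, rfl, hadj⟩; exact ⟨j, hadj, rfl⟩
  · rintro ⟨j, hadj, rfl⟩; exact ⟨j, rfl, hadj⟩

/-- Ring numbers along bonds of motif points are those of `y`. [folklore] -/
theorem ringNumber_toPoint {y : Fin N → E3} (hy : Function.Injective y) (hN : 0 < N) {η : ℝ}
    (hη1 : η ≤ 1) (hN2 : ∀ i : Fin N, ∃ j, j ≠ i) (i j : Fin N) :
    ringNumber η (Subtype.val : (periodiseFar y hN).points → E3) (toPoint y hN i)
      (toPoint y hN j) = ringNumber η y i j := by
  rw [ringNumber_def, ringNumber_def, neighborSet_toPoint hy hN hη1 hN2,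
    neighborSet_toPoint hy hN hη1 hN2, ← Set.image_inter (toPoint_injective hy hN),
    Set.ncard_image_of_injective _ (toPoint_injective hy hN)]

/-- **Charge of motif points read in the periodic point set = charge in `y`.** [folklore] -/
theorem isChargeFree_toPoint_iff {y : Fin N → E3} (hy : Function.Injective y) (hN : 0 < N)
    {η : ℝ} (hη1 : η ≤ 1) (hN2 : ∀ i : Fin N, ∃ j, j ≠ i) (i : Fin N) :
    IsChargeFree η (Subtype.val : (periodiseFar y hN).points → E3) (toPoint y hN i) ↔
      IsChargeFree η y i := by
  rw [isChargeFree_iff, isChargeFree_iff, neighborSet_toPoint hy hN hη1 hN2,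
    Set.ncard_image_of_injective _ (toPoint_injective hy hN), Set.forall_mem_image]
  refine and_congr_right fun _ => forall₂_congr fun j _ => ?_
  rw [ringNumber_toPoint hy hN hη1 hN2]

/-- The `yᵢ` are motif points of the far periodisation. [folklore] -/
theorem mem_motif_periodiseFar (y : Fin N → E3) (hN : 0 < N) (i : Fin N) :
    y i ∈ (periodiseFar y hN).motif := by
  rw [motif_periodiseFar]; exact Finset.mem_image_of_mem y (Finset.mem_univ i)

/-- Hence the far periodisation has exactly `#charged(y)` charged motif sites. [folklore] -/
theorem motifCharged_periodiseFar {y : Fin N → E3} (hy : Function.Injective y) (hN : 0 < N)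
    {η : ℝ} (hη1 : η ≤ 1) (hN2 : ∀ i : Fin N, ∃ j, j ≠ i) :
    motifCharged η (periodiseFar y hN) = charged η y := by
  unfold motifCharged charged
  let f : {i : Fin N // ¬ IsChargeFree η y i} →
      {x : (periodiseFar y hN).motif //
        ¬ IsChargeFree η (Subtype.val : (periodiseFar y hN).points → E3)
          ⟨x.1, (periodiseFar y hN).mem_points_of_mem_motif x.2⟩} :=
    fun i => ⟨⟨y i.1, mem_motif_periodiseFar y hN i.1⟩, by
      have h := i.2
      rw [← isChargeFree_toPoint_iff hy hN hη1 hN2] at h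
      exact h⟩
  have hf : Function.Bijective f := by
    constructor
    · intro a b hab
      have : y a.1 = y b.1 := congrArg (fun z => ((z.1 : (periodiseFar y hN).motif) : E3)) hab
      exact Subtype.ext (hy this)
    · rintro ⟨⟨v, hv⟩, hc⟩
      have hv' := hv
      rw [motif_periodiseFar] at hv'
      obtain ⟨i, -, rfl⟩ := Finset.mem_image.1 hv'
      refine ⟨⟨i, ?_⟩, rfl⟩
      rw [← isChargeFree_toPoint_iff hy hN hη1 hN2]
      exact hc
  exact (Nat.card_congr (Equiv.ofBijective f hf)).symm

/-- **Periodic pricing implies the allowance-free gap** (`η ≤ 1`; no `BddBelow` needed). [folklore] -/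
theorem noBoundary_of_periodicPricing {η κ : ℝ} (hη1 : η ≤ 1) (h : PeriodicPricing η κ) :
    NoBoundary η κ := by
  have main : ∀ {N : ℕ}, 2 ≤ N → ∀ (y : Fin N → E3), Function.Injective y →
      (N : ℝ) * eStar + κ * (charged η y : ℝ) ≤ interactionEnergy lennardJones y := by
    intro N hN y hy
    have hN0 : 0 < N := by omega
    have hN2 : ∀ i : Fin N, ∃ j, j ≠ i := exists_ne_of_two_le hN
    have hp := h (periodiseFar y hN0)
    rw [motifCharged_periodiseFar hy hN0 hη1 hN2] at hp
    have hcard : (((periodiseFar y hN0).motif.card : ℕ) : ℝ) = N := by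
      rw [motif_periodiseFar, Finset.card_image_of_injective _ hy, Finset.card_univ,
        Fintype.card_fin]
    rw [hcard] at hp
    have hNr : (0 : ℝ) < N := by exact_mod_cast hN0
    have he := energyPerParticle_periodise_le hy (spacingUnit y) (period_le_spacing y) hN0
    rw [le_div_iff₀ hNr, mul_comm] at he
    have he' : (N : ℝ) * (periodiseFar y hN0).energyPerParticle lennardJones ≤
        interactionEnergy lennardJones y := he
    nlinarith
  have hdimer : eStar + κ ≤ -1 / 24 := by
    have := main le_rfl dimer dimer_injective
    rw [charged_eq_of_le (by norm_num) dimer, interactionEnergy_dimer] at this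
    push_cast at this
    linarith
  intro N y hy
  rcases Nat.lt_or_ge N 2 with hN | hN
  · interval_cases N
    · rw [charged_zero, interactionEnergy_of_subsingleton]
      simp
    · rw [charged_eq_of_le (by norm_num) y, interactionEnergy_of_subsingleton]
      push_cast
      linarith
  · exact main hN y hy

/-- **`PeriodicPricing (1/100) κ` with `κ > 0` implies `ChargedEnergyGap`.** [folklore] -/
theorem chargedEnergyGap_of_periodicPricing {κ : ℝ} (hκ : 0 < κ)
    (h : PeriodicPricing (1 / 100) κ) : ChargedEnergyGap :=
  chargedEnergyGap_iff_noBoundary.2 ⟨κ, hκ, noBoundary_of_periodicPricing (by norm_num) h⟩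

end PeriodicForm

end Summit.AtomisticToContinuum.Crystallization.Theorems.ChargedEnergyGapNegative

end
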